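import Literature.NumberTheory.GaloisRepresentations.ResidualGaloisRep
import Literature.NumberTheory.GaloisRepresentations.FramedRepTwist
import Literature.NumberTheory.GaloisRepresentations.OrdinaryTwistedDeterminant
import Literature.NumberTheory.GaloisRepresentations.AbsolutelyIrreducibleReduction
import Mathlib.NumberTheory.Padics.RingHoms
import HarnessLib

/-!
# Residual representations of twists by residually trivial characters
# (the `2`-adic Tate twist does not change `ρ̄`)

Theorems only (no definition of a notion, no named fact; D-0026), written by the seat of the
named fact `Literature.NumberTheory.Automorphic.Allen2014_modularity_nearlyOrdinaryDihedral_Q`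
(Allen 2014, Theorem of the Introduction for `F = ℚ`), whose statement folds a Tate twist
`ρ ⊗ ε₂^a` into the hypotheses; the module docstring of that file justifies the rendering by
"hypotheses (3), (4), (5) and finite ramification are invariant under Tate twists (`ε₂(c)² = 1`;
`ε̄₂ = 1`, so `ρ ⊗ ε₂^a` and `ρ` have the same reductions; `ε₂` is unramified away from `2`)".
This file is the kernel-checked form of "`ρ ⊗ ε₂^a` and `ρ` have the same reductions":

* `exists_integralModel_twist` — if `ρ₀ : G → GL_n(O)` is an integral model of `ρ : G → GL_n(F)`
  in the frame `P` and `χ : G → Fˣ` is **residually trivial** (`χ(g) ∈ O`, `χ(g) ≡ 1 (mod 𝔪)`;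
  hypothesis `∀ g, ∃ u : O, ↑u = χ g ∧ residue u = 1`), then `ρ ⊗ χ` has an integral model in
  the same frame with THE SAME reduction.
* `isReductionOf_twist_iff`, `isResidualRepOf_twist_iff`, `isResiduallyAbsIrreducible_twist_iff`
  — hence `ρ ⊗ χ` and `ρ` have the same reductions, the same residual representations
  (semisimplified reductions) and are residually absolutely irreducible together.
* `FramedGaloisRep.residualRep_twist` — for `ρ : Γ_K → GL_n(ℚ̄_ℓ)`, the tree's chosen residual
  representation is literally unchanged: `(ρ ⊗ χ).residualRep = ρ.residualRep`.
* `exists_residue_eq_one_cyclotomicPadicAlgCl_two_zpow` — **the `2`-adic cyclotomic character is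
  residually trivial**: `ε₂(σ)^a ∈ ℤ₂ˣ = 1 + 2ℤ₂` reduces to `1` in `ℤ̄₂/𝔪` (`(ℤ/2)ˣ = {1}`); so
  all of the above applies to the Tate twists `ρ ⊗ ε₂^a` of a `2`-adic `ρ`
  (`FramedGaloisRep.residualRep_twist_cyclotomic_two`,
  `FramedGaloisRep.isResiduallyAbsIrreducible_twist_cyclotomic_two_iff`).

References: J.-P. Serre, *Abelian ℓ-adic representations and elliptic curves* (1968), Ch. I
§1.1 (lattices and reduction) [SerreAbelianLadic1968]; P. B. Allen, Compositio Math. 150 (2014),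
Introduction (arXiv:1301.1113, pp. 2–3) [Allen2014].
-/

noncomputable section

open scoped MatrixGroups NumberField
open Matrix IsLocalRing Field

namespace Literature.NumberTheory.GaloisRepresentations

/-! ### Residually trivial characters and integral models of twists -/

section Twist

variable {F : Type*} [Field F] [TopologicalSpace F] [IsTopologicalRing F] {O : ValuationSubring F}
variable {G : Type*} [Group G] [TopologicalSpace G] {n : ℕ} {k : Type*} [Field k]

/-- An element of a local ring with residue `1` is a unit. [folklore] -/
theorem isUnit_of_residue_eq_one {R : Type*} [CommRing R] [IsLocalRing R] {u : R}
    (hu : residue R u = 1) : IsUnit u := by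
  by_contra h
  have hmem : u ∈ maximalIdeal R := h
  rw [← residue_eq_zero_iff] at hmem
  rw [hmem] at hu
  exact zero_ne_one hu

/-- The inverse of a residually trivial character is residually trivial. [folklore] -/
theorem exists_residue_eq_one_inv {χ : G →ₜ* Fˣ}
    (hχ : ∀ g, ∃ u : O, (u : F) = (χ g : F) ∧ residue O u = 1) (g : G) :
    ∃ u : O, (u : F) = ((χ⁻¹ g : Fˣ) : F) ∧ residue O u = 1 := by
  obtain ⟨u, hu, hres⟩ := hχ g
  obtain ⟨w, rfl⟩ := isUnit_of_residue_eq_one hres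
  refine ⟨((w⁻¹ : Oˣ) : O), ?_, ?_⟩
  · have h1 : ((w : O) : F) * (((w⁻¹ : Oˣ) : O) : F) = 1 := by
      rw [← MulMemClass.coe_mul, ← Units.val_mul, mul_inv_cancel, Units.val_one, OneMemClass.coe_one]
    have h2 : ((χ⁻¹ g : Fˣ) : F) = ((χ g : F))⁻¹ := by
      rw [show χ⁻¹ g = (χ g)⁻¹ from rfl, Units.val_inv_eq_inv_val]
    rw [h2, ← hu]
    exact (eq_inv_of_mul_eq_one_right h1)
  · have h1 : residue O (w : O) * residue O ((w⁻¹ : Oˣ) : O) = 1 := by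
      rw [← map_mul, ← Units.val_mul, mul_inv_cancel, Units.val_one, map_one]
    rwa [hres, one_mul] at h1

omit [IsTopologicalRing F] in
/-- The scalar matrix `u · 1 ∈ GL_n(O)` of a unit `u` maps to `FramedRep.scalar F n (↑u)`. [folklore] -/
theorem map_unitsMap_scalar (w : Oˣ) :
    Matrix.GeneralLinearGroup.map O.subtype
        (Units.map (Matrix.scalar (Fin n) : O →+* Matrix (Fin n) (Fin n) O).toMonoidHom w) =
      FramedRep.scalar F n (Units.map O.subtype.toMonoidHom w) := by
  refine Units.ext (Matrix.ext fun i j => ?_)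
  rw [Matrix.GeneralLinearGroup.map_apply, FramedRep.coe_scalar_apply]
  simp only [Units.coe_map, RingHom.toMonoidHom_eq_coe, MonoidHom.coe_coe, Matrix.scalar_apply,
    Matrix.diagonal_apply, Matrix.algebraMap_matrix_apply, Algebra.algebraMap_self, RingHom.id_apply]
  split_ifs <;> simp

/-- **Integral models of twists by residually trivial characters** (Serre, *Abelian ℓ-adic
representations*, I §1.1): if `ρ₀ : G → GL_n(O)` is an integral model of `ρ` in the frame `P`
(`ρ₀ = P⁻¹ ρ P`) and `χ : G → Fˣ` takes values in `O` congruent to `1` modulo `𝔪`, then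
`g ↦ χ(g) ρ₀(g)` is an integral model of `ρ ⊗ χ` in the same frame, with the same reduction
along every residue embedding `ι`. [cite: SerreAbelianLadic1968, Ch. I §1.1] -/
theorem exists_integralModel_twist {ρ : FramedRep G F n} {ρ₀ : G →* GL (Fin n) O}
    {P : GL (Fin n) F} (hP : ∀ g, Matrix.GeneralLinearGroup.map O.subtype (ρ₀ g) = P⁻¹ * ρ g * P)
    {χ : G →ₜ* Fˣ} (hχ : ∀ g, ∃ u : O, (u : F) = (χ g : F) ∧ residue O u = 1) :
    ∃ ρ₁ : G →* GL (Fin n) O,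
      (∀ g, Matrix.GeneralLinearGroup.map O.subtype (ρ₁ g) = P⁻¹ * ρ.twist χ g * P) ∧
      ∀ ι : ResidueField O →+* k, integralReduction ι ρ₁ = integralReduction ι ρ₀ := by
  -- the conjugated twist takes values in `GL_n(O)`
  let φ : G →* GL (Fin n) F := (MulAut.conj P⁻¹).toMonoidHom.comp (ρ.twist χ).toMonoidHom
  have hφ : ∀ g, φ g = P⁻¹ * ρ.twist χ g * P := fun g => by simp [φ]
  have hφ' : ∀ g, φ g = FramedRep.scalar F n (χ g) * Matrix.GeneralLinearGroup.map O.subtype (ρ₀ g) :=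
    fun g => by
      rw [hφ, hP]
      have h := FramedRep.conj_twist_apply ρ χ P⁻¹ g
      simpa only [inv_inv] using h
  have hmem : ∀ g, φ g ∈ (Matrix.GeneralLinearGroup.map (n := Fin n) O.subtype).range := fun g => by
    obtain ⟨u, hu, hres⟩ := hχ g
    obtain ⟨w, rfl⟩ := isUnit_of_residue_eq_one hres
    have hw : Units.map O.subtype.toMonoidHom w = χ g := Units.ext hu
    refine ⟨Units.map (Matrix.scalar (Fin n) : O →+* Matrix (Fin n) (Fin n) O).toMonoidHom w * ρ₀ g, ?_⟩
    rw [map_mul, map_unitsMap_scalar, hw, hφ']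
  obtain ⟨ρ₁, hρ₁⟩ := exists_monoidHom_map_eq φ hmem
  refine ⟨ρ₁, fun g => (hρ₁ g).trans (hφ g), fun ι => MonoidHom.ext fun g => ?_⟩
  -- entrywise `ρ₁(g) = u ρ₀(g)` with `u ≡ 1`
  obtain ⟨u, hu, hres⟩ := hχ g
  have hentry : ∀ i j, ((ρ₁ g : GL (Fin n) O) : Matrix (Fin n) (Fin n) O) i j =
      u * ((ρ₀ g : GL (Fin n) O) : Matrix (Fin n) (Fin n) O) i j := fun i j => by
    apply O.subtype_injective
    have h := congrArg (fun M : GL (Fin n) F => (M : Matrix (Fin n) (Fin n) F) i j)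
      ((hρ₁ g).trans (hφ' g))
    simp only [Matrix.GeneralLinearGroup.map_apply, Matrix.GeneralLinearGroup.coe_mul,
      FramedRep.coe_scalar_apply] at h
    rw [h, map_mul, ← hu]
    simp [Matrix.mul_apply, Matrix.algebraMap_matrix_apply]
  refine Units.ext (Matrix.ext fun i j => ?_)
  rw [integralReduction_apply_coe, integralReduction_apply_coe, hentry, map_mul, map_mul, hres,
    map_one, one_mul]

/-- A reduction of `ρ` is a reduction of every twist `ρ ⊗ χ` by a residually trivial `χ`. [folklore] -/
theorem IsReductionOf.twist {ρ : FramedRep G F n} {ι : ResidueField O →+* k}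
    {τ : G →* GL (Fin n) k} (h : IsReductionOf ι (ρ : G →* GL (Fin n) F) τ) {χ : G →ₜ* Fˣ}
    (hχ : ∀ g, ∃ u : O, (u : F) = (χ g : F) ∧ residue O u = 1) :
    IsReductionOf ι (ρ.twist χ : G →* GL (Fin n) F) τ := by
  obtain ⟨ρ₀, Q, ⟨P, hP⟩, hQ⟩ := h
  obtain ⟨ρ₁, hP₁, hred⟩ := exists_integralModel_twist (k := k) hP hχ
  exact ⟨ρ₁, Q, ⟨P, hP₁⟩, fun g => by rw [hQ g, hred ι]⟩

/-- **`ρ ⊗ χ` and `ρ` have the same reductions** for a residually trivial `χ`. [folklore] -/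
theorem isReductionOf_twist_iff {ρ : FramedRep G F n} {ι : ResidueField O →+* k}
    {τ : G →* GL (Fin n) k} {χ : G →ₜ* Fˣ}
    (hχ : ∀ g, ∃ u : O, (u : F) = (χ g : F) ∧ residue O u = 1) :
    IsReductionOf ι (ρ.twist χ : G →* GL (Fin n) F) τ ↔ IsReductionOf ι (ρ : G →* GL (Fin n) F) τ := by
  refine ⟨fun h => ?_, fun h => h.twist hχ⟩
  have h' := h.twist (exists_residue_eq_one_inv hχ)
  rwa [FramedRep.twist_twist_inv] at h'

/-- **`ρ ⊗ χ` and `ρ` have the same residual representations** (semisimplified reductions) for a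
residually trivial `χ`. [folklore] -/
theorem isResidualRepOf_twist_iff {ρ : FramedRep G F n} {ι : ResidueField O →+* k}
    {τ : G →* GL (Fin n) k} {χ : G →ₜ* Fˣ}
    (hχ : ∀ g, ∃ u : O, (u : F) = (χ g : F) ∧ residue O u = 1) :
    IsResidualRepOf ι (ρ.twist χ : G →* GL (Fin n) F) τ ↔
      IsResidualRepOf ι (ρ : G →* GL (Fin n) F) τ := by
  simp only [IsResidualRepOf, isReductionOf_twist_iff hχ]

/-- **`ρ ⊗ χ` is residually absolutely irreducible iff `ρ` is**, for a residually trivial `χ`. [folklore] -/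
theorem isResiduallyAbsIrreducible_twist_iff {ρ : FramedRep G F n} {χ : G →ₜ* Fˣ}
    (hχ : ∀ g, ∃ u : O, (u : F) = (χ g : F) ∧ residue O u = 1) :
    IsResiduallyAbsIrreducible O (ρ.twist χ : G →* GL (Fin n) F) ↔
      IsResiduallyAbsIrreducible O (ρ : G →* GL (Fin n) F) := by
  simp only [IsResiduallyAbsIrreducible, isReductionOf_twist_iff hχ]

end Twist

/-! ### The `ℚ̄_ℓ` case: the chosen residual representation of a twist -/

section PadicAlgCl

variable {K : Type*} [Field K] {ℓ : ℕ} [Fact ℓ.Prime] {n : ℕ}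

/-- `dite` on an existential with `Exists.choose` only depends on the predicate (variant of the
tree's `dite_exists_choose_congr` of `SatakeFamilyOfFramedGaloisRep` with arbitrary `Decidable`
instances, kept private to avoid importing that automorphic-side file here). [folklore] -/
private theorem dite_exists_choose_congr_of_decidable {α : Sort*} {P Q : α → Prop} (e : P = Q) (d : α)
    {dP : Decidable (∃ x, P x)} {dQ : Decidable (∃ x, Q x)} :
    (@dite α (∃ x, P x) dP (fun h => h.choose) fun _ => d) =
      @dite α (∃ x, Q x) dQ (fun h => h.choose) fun _ => d := by
  subst e
  congr

/-- **The residual representation of a twist by a residually trivial character is unchanged**: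
`(ρ ⊗ χ).residualRep = ρ.residualRep` for `ρ : Γ_K → GL_n(ℚ̄_ℓ)` and `χ : Γ_K → ℚ̄_ℓˣ` with
`χ(σ) ∈ ℤ̄_ℓ`, `χ(σ) ≡ 1 (mod 𝔪)` (the two representations have the same residual
representations, and `residualRep` is a choice among them). [folklore] -/
theorem FramedGaloisRep.residualRep_twist {ρ : FramedGaloisRep K (PadicAlgCl ℓ) n}
    {χ : absoluteGaloisGroup K →ₜ* (PadicAlgCl ℓ)ˣ}
    (hχ : ∀ σ, ∃ u : padicAlgClIntegers ℓ, (u : PadicAlgCl ℓ) = (χ σ : PadicAlgCl ℓ) ∧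
      residue (padicAlgClIntegers ℓ) u = 1) :
    FramedGaloisRep.residualRep (FramedRep.twist ρ χ) = ρ.residualRep := by
  have e : (fun τ => FramedGaloisRep.IsResidualRepOf (FramedRep.twist ρ χ) (RingHom.id _) τ) =
      fun τ => ρ.IsResidualRepOf (RingHom.id _) τ :=
    funext fun τ => propext (isResidualRepOf_twist_iff hχ)
  unfold FramedGaloisRep.residualRep
  exact dite_exists_choose_congr_of_decidable e 1

/-- `(ρ ⊗ χ).IsResiduallyAbsIrreducible ↔ ρ.IsResiduallyAbsIrreducible` for `ρ : Γ_K → GL_n(ℚ̄_ℓ)`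
and a residually trivial `χ`. [folklore] -/
theorem FramedGaloisRep.isResiduallyAbsIrreducible_twist_iff {ρ : FramedGaloisRep K (PadicAlgCl ℓ) n}
    {χ : absoluteGaloisGroup K →ₜ* (PadicAlgCl ℓ)ˣ}
    (hχ : ∀ σ, ∃ u : padicAlgClIntegers ℓ, (u : PadicAlgCl ℓ) = (χ σ : PadicAlgCl ℓ) ∧
      residue (padicAlgClIntegers ℓ) u = 1) :
    FramedGaloisRep.IsResiduallyAbsIrreducible (FramedRep.twist ρ χ) ↔ ρ.IsResiduallyAbsIrreducible :=
  GaloisRepresentations.isResiduallyAbsIrreducible_twist_iff hχ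

/-- `(ρ ⊗ χ).IsResidualRepOf ι τ ↔ ρ.IsResidualRepOf ι τ` for `ρ : Γ_K → GL_n(ℚ̄_ℓ)` and a
residually trivial `χ`. [folklore] -/
theorem FramedGaloisRep.isResidualRepOf_twist_iff {ρ : FramedGaloisRep K (PadicAlgCl ℓ) n}
    {χ : absoluteGaloisGroup K →ₜ* (PadicAlgCl ℓ)ˣ}
    (hχ : ∀ σ, ∃ u : padicAlgClIntegers ℓ, (u : PadicAlgCl ℓ) = (χ σ : PadicAlgCl ℓ) ∧
      residue (padicAlgClIntegers ℓ) u = 1)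
    {κ : Type*} [Field κ] {ι : padicAlgClResidueField ℓ →+* κ} {τ : absoluteGaloisGroup K →* GL (Fin n) κ} :
    FramedGaloisRep.IsResidualRepOf (FramedRep.twist ρ χ) ι τ ↔ ρ.IsResidualRepOf ι τ :=
  GaloisRepresentations.isResidualRepOf_twist_iff hχ

end PadicAlgCl

/-! ### The `2`-adic cyclotomic character is residually trivial -/

section Two

/-- An element of `ℤ̄_ℓ` at distance `< 1` from `1` has residue `1` (a unit of the valuation ring
has norm `1`). [folklore] -/
theorem residue_eq_one_of_norm_sub_one_lt_one {ℓ : ℕ} [Fact ℓ.Prime] {u : padicAlgClIntegers ℓ}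
    (h : ‖(u : PadicAlgCl ℓ) - 1‖ < 1) : residue (padicAlgClIntegers ℓ) u = 1 := by
  rw [← sub_eq_zero, ← map_one (residue (padicAlgClIntegers ℓ)), ← map_sub, residue_eq_zero_iff,
    mem_maximalIdeal, mem_nonunits_iff]
  rintro ⟨w, hw⟩
  have h1 : ((w : padicAlgClIntegers ℓ) : PadicAlgCl ℓ) *
      (((w⁻¹ : (padicAlgClIntegers ℓ)ˣ) : padicAlgClIntegers ℓ) : PadicAlgCl ℓ) = 1 := by
    rw [← MulMemClass.coe_mul, ← Units.val_mul, mul_inv_cancel, Units.val_one, OneMemClass.coe_one]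
  have hle : ‖(((w⁻¹ : (padicAlgClIntegers ℓ)ˣ) : padicAlgClIntegers ℓ) : PadicAlgCl ℓ)‖ ≤ 1 :=
    (padicAlgCl_mem_valuationSubring_iff ℓ _).mp (SetLike.coe_mem _)
  have hlt : ‖((w : padicAlgClIntegers ℓ) : PadicAlgCl ℓ)‖ < 1 := by
    rw [hw, AddSubgroupClass.coe_sub, OneMemClass.coe_one]
    exact h
  have h2 := congrArg (‖·‖) h1
  simp only [norm_mul, norm_one] at h2
  have h3 : ‖((w : padicAlgClIntegers ℓ) : PadicAlgCl ℓ)‖ *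
      ‖(((w⁻¹ : (padicAlgClIntegers ℓ)ˣ) : padicAlgClIntegers ℓ) : PadicAlgCl ℓ)‖ < 1 * 1 :=
    mul_lt_mul' hlt.le (lt_of_le_of_ne hle fun h1' => by
      rw [h1', mul_one] at h2; exact hlt.ne h2) (norm_nonneg _) one_pos
  rw [h2, mul_one] at h3
  exact lt_irrefl _ h3

/-- A unit of `ℤ₂` is congruent to `1` modulo `2`: `‖y - 1‖ < 1`. [folklore] -/
theorem PadicInt.norm_sub_one_lt_one_of_isUnit_two {y : ℤ_[2]} (hy : IsUnit y) : ‖y - 1‖ < 1 := by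
  have h1 : PadicInt.toZMod y = 1 := by
    obtain ⟨w, hw⟩ := hy.map (PadicInt.toZMod (p := 2))
    -- all units of `ℤ/2` are `1`
    have hall : ∀ w' : (ZMod 2)ˣ, w' = 1 := by decide
    rw [← hw, hall w, Units.val_one]
  have hker : y - 1 ∈ RingHom.ker (PadicInt.toZMod (p := 2)) := by
    rw [RingHom.mem_ker, map_sub, h1, map_one, sub_self]
  rw [PadicInt.ker_toZMod] at hker
  exact PadicInt.mem_nonunits.mp hker

/-- `algebraMap ℤ_ℓ ℚ̄_ℓ` is an isometry. [folklore] -/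
theorem norm_algebraMap_padicInt_padicAlgCl {ℓ : ℕ} [Fact ℓ.Prime] (z : ℤ_[ℓ]) :
    ‖algebraMap ℤ_[ℓ] (PadicAlgCl ℓ) z‖ = ‖z‖ := by
  rw [IsScalarTower.algebraMap_apply ℤ_[ℓ] ℚ_[ℓ] (PadicAlgCl ℓ), norm_algebraMap', PadicInt.norm_def]
  rfl

/-- **The `2`-adic cyclotomic character and its powers are residually trivial**: for every
`σ ∈ Γ_K` and `a ∈ ℤ`, `ε₂(σ)^a` is (the image of) an element of `ℤ̄₂` with residue `1` — indeed
`ε₂(σ)^a ∈ ℤ₂ˣ = 1 + 2ℤ₂`.  ("`ε̄₂ = 1`, so `ρ ⊗ ε₂^a` and `ρ` have the same reductions",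
Allen-file module docstring.) [folklore] -/
theorem exists_residue_eq_one_cyclotomicPadicAlgCl_two_zpow {K : Type} [Field K]
    (σ : absoluteGaloisGroup K) (a : ℤ) :
    ∃ u : padicAlgClIntegers 2,
      (u : PadicAlgCl 2) = ((cyclotomicPadicAlgCl K 2 σ ^ a : (PadicAlgCl 2)ˣ) : PadicAlgCl 2) ∧
      residue (padicAlgClIntegers 2) u = 1 := by
  set c : ℤ_[2]ˣ := GaloisRep.cyclotomicCharacter K 2 σ ^ a with hc
  have hval : ((cyclotomicPadicAlgCl K 2 σ ^ a : (PadicAlgCl 2)ˣ) : PadicAlgCl 2) =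
      algebraMap ℤ_[2] (PadicAlgCl 2) (c : ℤ_[2]) := by
    have h1 : cyclotomicPadicAlgCl K 2 σ =
        Units.map (algebraMap ℤ_[2] (PadicAlgCl 2) : ℤ_[2] →* PadicAlgCl 2)
          (GaloisRep.cyclotomicCharacter K 2 σ) := rfl
    rw [h1, ← map_zpow, hc]
    rfl
  have hmem : algebraMap ℤ_[2] (PadicAlgCl 2) (c : ℤ_[2]) ∈ padicAlgClIntegers 2 := by
    rw [padicAlgCl_mem_valuationSubring_iff, norm_algebraMap_padicInt_padicAlgCl]
    exact PadicInt.norm_le_one _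
  refine ⟨⟨_, hmem⟩, hval.symm, residue_eq_one_of_norm_sub_one_lt_one ?_⟩
  change ‖algebraMap ℤ_[2] (PadicAlgCl 2) (c : ℤ_[2]) - 1‖ < 1
  rw [← map_one (algebraMap ℤ_[2] (PadicAlgCl 2)), ← map_sub, norm_algebraMap_padicInt_padicAlgCl]
  exact PadicInt.norm_sub_one_lt_one_of_isUnit_two (Units.isUnit c)

variable {K : Type} [Field K] {n : ℕ}

/-- **A `2`-adic `ρ : Γ_K → GL_n(ℚ̄₂)` and its Tate twists `ρ ⊗ ε₂^a` have the same chosen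
residual representation.** [folklore] -/
theorem FramedGaloisRep.residualRep_twist_cyclotomic_two {ρ : FramedGaloisRep K (PadicAlgCl 2) n}
    {χ₀ : absoluteGaloisGroup K →ₜ* (PadicAlgCl 2)ˣ} {a : ℤ}
    (hχ₀ : ∀ σ, χ₀ σ = cyclotomicPadicAlgCl K 2 σ ^ a) :
    FramedGaloisRep.residualRep (FramedRep.twist ρ χ₀) = ρ.residualRep :=
  FramedGaloisRep.residualRep_twist fun σ => by
    rw [hχ₀ σ]
    exact exists_residue_eq_one_cyclotomicPadicAlgCl_two_zpow σ a

/-- **A `2`-adic `ρ : Γ_K → GL_n(ℚ̄₂)` is residually absolutely irreducible iff its Tate twist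
`ρ ⊗ ε₂^a` is.** [folklore] -/
theorem FramedGaloisRep.isResiduallyAbsIrreducible_twist_cyclotomic_two_iff
    {ρ : FramedGaloisRep K (PadicAlgCl 2) n} {χ₀ : absoluteGaloisGroup K →ₜ* (PadicAlgCl 2)ˣ} {a : ℤ}
    (hχ₀ : ∀ σ, χ₀ σ = cyclotomicPadicAlgCl K 2 σ ^ a) :
    FramedGaloisRep.IsResiduallyAbsIrreducible (FramedRep.twist ρ χ₀) ↔ ρ.IsResiduallyAbsIrreducible :=
  FramedGaloisRep.isResiduallyAbsIrreducible_twist_iff fun σ => by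
    rw [hχ₀ σ]
    exact exists_residue_eq_one_cyclotomicPadicAlgCl_two_zpow σ a

end Two

end Literature.NumberTheory.GaloisRepresentations
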